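import Summits.QuantumFields.YangMills.Theorems.LuscherReductionTwistedTraceScalingBOGaugeAvgRider
import Summits.QuantumFields.YangMills.Theorems.LuscherReductionTwistedTraceScalingChartTransport
import HarnessLib

/-!
# (C1-γ) THE CAP-BALANCED RESTRICTION OF A FIBRE PROFILE: same BO functions, and the support hypothesis `hΩt` of the (C1)/(C4) glue
# (lane A of S-BASE, crux `TwistedTraceScaling` stmt-QuantumFields-20203, C4-CORE, the (OD) pen; `pub/ym-fleet/ym-luscher-20007-p1/COARSE-DESIGN.md` §27–§29)

The (B-OD) glue (`…BOTransportEnvelope`, `…BOCoreTransfer.colour_fpFibreTransfer_two_sided`, `…BOCentralGlue/Tube/GlueInner`) carries the support hypothesis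
`hΩt : Ω(linkEmbed v) ≠ 0 → v ∈ capBalancedSet ∧ |v_{e,c}| ≤ T ∧ ‖linkEmbed v‖ ≤ R`.  The literal profile of record `Ω_G = frozenProfile L q_f r_f β` violates the first conjunct (it is
non-zero at every small `x`), but only its values on `linkEmbed(capBalancedSet)` are ever used: every BO function evaluates `Ω` at `relLinkVec` of a point of the orthographic tube, which IS
`linkEmbed` of a cap-balanced vector (`…OrthoTubeCoords.relLinkVec_orthoTube`).  So the glue is run with the CAP-BALANCED RESTRICTION
`Ω_c = 𝟙{linkCurry x ∈ capBalancedSet}·Ω` (written inline, no new definition):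
* `measurable_capRestrict`, `capRestrict_mem` (`0 ≤ Ω_c ≤ Ω`, `|Ω_c| ≤ C_Ω`);
* ★ `boFun_capRestrict` — `boFun φ Ω_c = boFun φ Ω` for EVERY `φ, Ω`;
* ★ `capRestrict_frozenProfile_support` — `hΩt` for `Ω_c` with `Ω = frozenProfile L q_f r_f β`: `Ω_c(linkEmbed v) ≠ 0 → v ∈ capBalancedSet ∧ (∀ e c, |v e c| ≤ r_f β) ∧ ‖linkEmbed v‖ ≤ r_f β`;
* `capRestrict_adL` — `Ω_c` is colour blind when `Ω` is.
HONEST FRAMING: support bookkeeping for a stub of a child of the CONDITIONAL route R2b1; (C1) rates, (C4), (C5), (B-ST) OPEN; C4-CORE OPEN; not infinite volume, not a gap, not Clay.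
-/

set_option autoImplicit false

noncomputable section

open MeasureTheory Real
open scoped BigOperators RealInnerProductSpace
open Literature.MathematicalPhysics.QuantumFieldTheory
open Literature.MathematicalPhysics.QuantumLattice

namespace Summit.QuantumFields.YangMills.Theorems.FemtoTransferGap.TwoLattice.ConstTube

open Summit.QuantumFields.YangMills.Theorems.FemtoTransferGap
open Summit.QuantumFields.YangMills.Theorems.FemtoTransferGap.TwoLattice
open Summit.QuantumFields.YangMills.Theorems.FemtoTransferGap.TwoLattice.Avg
open Summit.QuantumFields.YangMills.Theorems.FemtoTransferGap.TwoLattice.Stiff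
open Summit.QuantumFields.YangMills.Theorems.FemtoTransferGap.TwoLattice.GnChart

variable {L : ℕ} [NeZero L]

/-! ## §1 The cap-balanced part of `LinkSpace L` -/

/-- The set `{x | linkCurry x ∈ capBalancedSet}` is measurable. [folklore] -/
theorem measurableSet_capLink : MeasurableSet {x : LinkSpace L | linkCurry x ∈ capBalancedSet L} :=
  (chartEquiv L).symm.measurable (measurableSet_capBalancedSet L)

/-- `linkEmbed v` lies in it iff `v ∈ capBalancedSet`. [folklore] -/
theorem linkEmbed_mem_capLink_iff (v : Edge 3 L → Fin 3 → ℝ) : linkEmbed L v ∈ {x : LinkSpace L | linkCurry x ∈ capBalancedSet L} ↔ v ∈ capBalancedSet L := by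
  rw [Set.mem_setOf_eq, ← chartVec_eq_linkEmbed, linkCurry_chartVec]

/-- The cap-balanced restriction `Ω_c = 𝟙_cap·Ω` is measurable. [folklore] -/
theorem measurable_capRestrict {Ω : LinkSpace L → ℝ} (hΩ : Measurable Ω) :
    Measurable fun x : LinkSpace L => {x : LinkSpace L | linkCurry x ∈ capBalancedSet L}.indicator (fun _ => (1 : ℝ)) x * Ω x :=
  (measurable_const.indicator measurableSet_capLink).mul hΩ

/-- `0 ≤ Ω_c ≤ Ω` and `|Ω_c| ≤ C_Ω` for `0 ≤ Ω`, `|Ω| ≤ C_Ω`. [folklore] -/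
theorem capRestrict_mem {Ω : LinkSpace L → ℝ} (hΩ0 : ∀ x, 0 ≤ Ω x) {CΩ : ℝ} (hCΩ : ∀ x, |Ω x| ≤ CΩ) (x : LinkSpace L) :
    0 ≤ {x : LinkSpace L | linkCurry x ∈ capBalancedSet L}.indicator (fun _ => (1 : ℝ)) x * Ω x ∧
      {x : LinkSpace L | linkCurry x ∈ capBalancedSet L}.indicator (fun _ => (1 : ℝ)) x * Ω x ≤ Ω x ∧
      |{x : LinkSpace L | linkCurry x ∈ capBalancedSet L}.indicator (fun _ => (1 : ℝ)) x * Ω x| ≤ CΩ := by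
  by_cases hx : x ∈ {x : LinkSpace L | linkCurry x ∈ capBalancedSet L}
  · rw [Set.indicator_of_mem hx, one_mul]; exact ⟨hΩ0 x, le_rfl, hCΩ x⟩
  · rw [Set.indicator_of_notMem hx, zero_mul, abs_zero]; exact ⟨le_rfl, hΩ0 x, (abs_nonneg _).trans (hCΩ x)⟩

/-- `Ω_c` is colour blind when `Ω` is (`linkCurry (Ad_g x) = colourRotate g (linkCurry x)` stays cap-balanced). [folklore] -/
theorem capRestrict_adL {Ω : LinkSpace L → ℝ} (hΩinv : ∀ (g : SU2) (x : LinkSpace L), Ω (adL L g x) = Ω x) (g : SU2) (x : LinkSpace L) :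
    {x : LinkSpace L | linkCurry x ∈ capBalancedSet L}.indicator (fun _ => (1 : ℝ)) (adL L g x) * Ω (adL L g x) =
      {x : LinkSpace L | linkCurry x ∈ capBalancedSet L}.indicator (fun _ => (1 : ℝ)) x * Ω x := by
  rw [hΩinv]
  have hmem : adL L g x ∈ {x : LinkSpace L | linkCurry x ∈ capBalancedSet L} ↔ x ∈ {x : LinkSpace L | linkCurry x ∈ capBalancedSet L} := by
    have e1 : adL L g x = linkEmbed L (colourRotate L (fun _ => g) (linkCurry x)) := by
      rw [linkEmbed_colourRotate_const, ← chartVec_eq_linkEmbed, chartVec_linkCurry]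
    constructor
    · intro h
      rw [e1, linkEmbed_mem_capLink_iff] at h
      have h' := colourRotate_mem_capBalancedSet L (r := fun _ => g⁻¹) h
      rw [colourRotate_mul] at h'
      have hone : ((fun _ : Fin 3 => g⁻¹) * fun _ : Fin 3 => g) = (1 : Fin 3 → SU2) := by funext k; simp
      rw [hone] at h'
      have hid : colourRotate L (1 : Fin 3 → SU2) (linkCurry x) = linkCurry x := by
        funext e; simp [colourRotate, Cov.adRot_one]
      rw [hid] at h'
      exact h'
    · intro h
      rw [e1, linkEmbed_mem_capLink_iff]
      have hx : linkCurry x ∈ capBalancedSet L := h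
      exact colourRotate_mem_capBalancedSet L hx
  by_cases hx : x ∈ {x : LinkSpace L | linkCurry x ∈ capBalancedSet L}
  · rw [Set.indicator_of_mem hx, Set.indicator_of_mem (hmem.2 hx)]
  · rw [Set.indicator_of_notMem hx, Set.indicator_of_notMem (fun h => hx (hmem.1 h))]

/-! ## §2 ★ Same BO functions; the support hypothesis of the glue -/

/-- On the orthographic tube the relative coordinate is cap-balanced: `relLinkVec U ∈ linkEmbed(capBalancedSet)`. [folklore] -/
theorem relLinkVec_mem_capLink {U : GaugeConfig 3 L SU2} (hU : U ∈ orthoTubeSet L) : relLinkVec L U ∈ {x : LinkSpace L | linkCurry x ∈ capBalancedSet L} := by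
  obtain ⟨u, v, hv, rfl⟩ := hU
  rw [relLinkVec_orthoTube L u hv, linkEmbed_mem_capLink_iff]; exact hv

/-- ★ **The cap-balanced restriction has the same BO functions**: `boFun φ Ω_c = boFun φ Ω` for every `φ, Ω`. [folklore] -/
theorem boFun_capRestrict (φ : GaugeConfig 3 1 SU2 → ℝ) (Ω : LinkSpace L → ℝ) :
    boFun L φ (fun x => {x : LinkSpace L | linkCurry x ∈ capBalancedSet L}.indicator (fun _ => (1 : ℝ)) x * Ω x) = boFun L φ Ω := by
  funext U
  unfold boFun
  by_cases hU : U ∈ orthoTubeSet L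
  · rw [Set.indicator_of_mem hU]; dsimp only
    rw [Set.indicator_of_mem (relLinkVec_mem_capLink hU)]; ring
  · rw [Set.indicator_of_notMem hU, zero_mul, zero_mul]

/-- ★ **The support hypothesis `hΩt` of the (C1)/(C4) glue for the cap-balanced restriction of the profile of record**: `Ω_c(linkEmbed v) ≠ 0 → v ∈ capBalancedSet ∧ (∀ e c, |v e c| ≤ r_f β)
∧ ‖linkEmbed v‖ ≤ r_f β`. [folklore] -/
theorem capRestrict_frozenProfile_support (qf : ℝ → LinkSpace L → ℝ) (rf : ℝ → ℝ) (β : ℝ) (v : Edge 3 L → Fin 3 → ℝ)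
    (hv : {x : LinkSpace L | linkCurry x ∈ capBalancedSet L}.indicator (fun _ => (1 : ℝ)) (linkEmbed L v) * frozenProfile L qf rf β (linkEmbed L v) ≠ 0) :
    v ∈ capBalancedSet L ∧ (∀ (e : Edge 3 L) (c : Fin 3), |v e c| ≤ rf β) ∧ ‖linkEmbed L v‖ ≤ rf β := by
  have hcap : v ∈ capBalancedSet L := by
    by_contra h
    apply hv
    rw [Set.indicator_of_notMem (fun h' => h ((linkEmbed_mem_capLink_iff v).1 h')), zero_mul]
  have hΩ : frozenProfile L qf rf β (linkEmbed L v) ≠ 0 := right_ne_zero_of_mul hv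
  have hnorm := norm_le_of_frozenProfile_ne_zero qf rf β hΩ
  refine ⟨hcap, fun e c => ?_, hnorm⟩
  have h1 : |v e c| ≤ ‖linkEmbed L v‖ := by
    have h := EuclideanSpace.norm_sq_eq (linkEmbed L v)
    have h2 : ‖(linkEmbed L v) (e, c)‖ ^ 2 ≤ ∑ ea, ‖(linkEmbed L v) ea‖ ^ 2 :=
      Finset.single_le_sum (f := fun ea => ‖(linkEmbed L v) ea‖ ^ 2) (fun ea _ => sq_nonneg _) (Finset.mem_univ (e, c))
    rw [← h] at h2
    have h3 : ‖(linkEmbed L v) (e, c)‖ = |v e c| := by rw [linkEmbed_apply, Real.norm_eq_abs]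
    rw [h3] at h2
    exact abs_le_of_sq_le_sq' (by linarith [sq_abs (v e c)]) (norm_nonneg _) |>.2 |> fun h4 => by
      exact (pow_le_pow_iff_left₀ (abs_nonneg _) (norm_nonneg _) two_ne_zero).1 (by rw [sq_abs] at h2 ⊢; exact h2)
  exact h1.trans hnorm

end Summit.QuantumFields.YangMills.Theorems.FemtoTransferGap.TwoLattice.ConstTube

end
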